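import Summits.AtomisticToContinuum.HydrodynamicLimit.Theorems.RelayRaceLocalityNearConstantShortTimeHLAssemblyTheta
import Literature.MathematicalPhysics.KineticTheory.HardSphereEulerLocalTheoryProofs
import Mathlib.Analysis.Calculus.MeanValue
import HarnessLib

/-!
# Crux `NearConstantShortTimeHL` (stmt-AtomisticToContinuum-12502), line `small-tilt-domination` — closeness of the tilt

Support file for the crux `…Theses.RelayRaceLocality.NearConstantShortTimeHL`, line `small-tilt-domination`, stub `tilt_closeness`
(route: import events from the near-constant local Gibbs law to the invariant constant-profile Gibbs law via `TiltDomination`, which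
needs the activity profile `a₀ = ρ₀ e^{g_σ(ρ₀)}` to be close to a constant in LOG scale).

* `tilt_closeness` — if the Euler density datum is `δ₀`-close to the constant state `ρ ≡ 1` (`|ρ₀ x − 1| ≤ δ₀ ≤ 1/2`) and the packing
  `ρ₀ σ³` stays below `η₀/2`, then `a₀ = ρ₀ e^{g_σ(ρ₀)} > 0` and `|log a₀| ≤ 2δ₀ + K_G σ³`, with `K_G ≥ 0` depending only on the analytic
  equation of state `F` (`f_ex = F` on `[0, η₀)`, `F` analytic on `(-η₀, η₀)`, `F 0 = 0`).

Proof: `log a₀ = log ρ₀ + g_σ(ρ₀)`; `|log r| ≤ 2|r − 1|` for `r ≥ 1/2` (`xm_abs_log_le`); and `g_σ(r) = G(rσ³)` with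
`G(η) = F(η) + ηF′(η)` analytic on `(-η₀, η₀)`, `G(0) = 0`, so `|G η| ≤ B η` on `[0, η₀/2]` by the mean value inequality with
`B = sup |G′|` over that compact interval (`xm_G_bound`); take `K_G = 3B/2` (as `ρ₀ ≤ 3/2`).
-/

noncomputable section

namespace Summit.AtomisticToContinuum.HydrodynamicLimit.Theorems.NearConstantShortTimeHL

open scoped BigOperators ENNReal Topology
open MeasureTheory Set Filter
open Literature.MathematicalPhysics.KineticTheory Literature.Analysis.FluidPDE Literature.Analysis.FunctionSpaces

/-- `|log r| ≤ 2δ` whenever `|r − 1| ≤ δ ≤ 1/2` (upper: `log r ≤ r − 1`; lower: `log r ≥ 1 − 1/r ≥ −2δ` as `r(1 + 2δ) ≥ (1 − δ)(1 + 2δ) ≥ 1`).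
[folklore] -/
private theorem xm_abs_log_le {r δ : ℝ} (hδ : δ ≤ 1 / 2) (hr : |r - 1| ≤ δ) : |Real.log r| ≤ 2 * δ := by
  obtain ⟨h1, h2⟩ := abs_le.1 hr
  have hδ0 : 0 ≤ δ := (abs_nonneg _).trans hr
  have hr0 : 0 < r := by linarith
  refine abs_le.2 ⟨?_, ?_⟩
  · -- lower bound
    have hlog := Real.one_sub_inv_le_log_of_pos hr0
    have hprod : 1 ≤ r * (1 + 2 * δ) := by
      nlinarith [mul_le_mul_of_nonneg_right (show 1 - δ ≤ r by linarith) (show (0 : ℝ) ≤ 1 + 2 * δ by linarith),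
        mul_nonneg hδ0 (show (0 : ℝ) ≤ 1 - 2 * δ by linarith)]
    have hinv : r⁻¹ ≤ 1 + 2 * δ :=
      calc r⁻¹ = r⁻¹ * 1 := (mul_one _).symm
        _ ≤ r⁻¹ * (r * (1 + 2 * δ)) := mul_le_mul_of_nonneg_left hprod (inv_nonneg.2 hr0.le)
        _ = 1 + 2 * δ := by rw [← mul_assoc, inv_mul_cancel₀ hr0.ne', one_mul]
    linarith
  · -- upper bound
    have hlog := Real.log_le_sub_one_of_pos hr0
    linarith

/-- **Linear bound for `G = F + id · F′` at small packing.** If `F` is analytic on `(-η₀, η₀)` with `F 0 = 0`, then for some `B ≥ 0`: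
`|F η + η F′(η)| ≤ B η` for all `η ∈ [0, η₀/2]` (mean value inequality on the compact convex interval, where `G′` is continuous hence
bounded). [folklore] -/
private theorem xm_G_bound {η₀ : ℝ} {F : ℝ → ℝ} (hη₀ : 0 < η₀) (hFa : AnalyticOnNhd ℝ F (Set.Ioo (-η₀) η₀)) (hF0 : F 0 = 0) :
    ∃ B : ℝ, 0 ≤ B ∧ ∀ η ∈ Set.Icc 0 (η₀ / 2), |F η + η * deriv F η| ≤ B * η := by
  have hGa : AnalyticOnNhd ℝ (fun η => F η + η * deriv F η) (Ioo (-η₀) η₀) := fun η hη =>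
    (hFa η hη).fun_add (analyticAt_id.fun_mul (hFa.deriv η hη))
  have hsub : Icc 0 (η₀ / 2) ⊆ Ioo (-η₀) η₀ := fun η hη => ⟨by linarith [hη.1], by linarith [hη.2]⟩
  have hcont : ContinuousOn (deriv fun η => F η + η * deriv F η) (Icc 0 (η₀ / 2)) :=
    hGa.deriv.continuousOn.mono hsub
  obtain ⟨C, hC⟩ := isCompact_Icc.exists_bound_of_continuousOn hcont
  refine ⟨max C 0, le_max_right _ _, fun η hη => ?_⟩
  have h0 : (0 : ℝ) ∈ Icc 0 (η₀ / 2) := ⟨le_rfl, by linarith⟩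
  have hmvt := Convex.norm_image_sub_le_of_norm_deriv_le (𝕜 := ℝ) (f := fun η => F η + η * deriv F η)
    (s := Icc 0 (η₀ / 2)) (fun x hx => (hGa x (hsub hx)).differentiableAt)
    (C := max C 0) (fun x hx => (hC x hx).trans (le_max_left C 0)) (convex_Icc 0 (η₀ / 2)) h0 hη
  simp only [hF0, zero_mul, add_zero, sub_zero, Real.norm_eq_abs] at hmvt
  rwa [abs_of_nonneg hη.1] at hmvt

/-- **Closeness of the tilt (stub `tilt_closeness`).** Under the equation-of-state hypothesis (`f_ex = F` on `[0, η₀)`, `F` analytic on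
`(-η₀, η₀)`, `F 0 = 0`) there is `K_G ≥ 0` such that for every reduced diameter `σ > 0` and every density datum `ρ₀` with `|ρ₀ − 1| ≤ δ₀ ≤ 1/2`
and packing `ρ₀ σ³ ≤ η₀/2`, the activity `a₀ = ρ₀ e^{g_σ(ρ₀)}` is positive and `|log a₀| ≤ 2δ₀ + K_G σ³` pointwise. [folklore] -/
theorem tilt_closeness : ∀ {η₀ : ℝ} {F : ℝ → ℝ}, 0 < η₀ → AnalyticOnNhd ℝ F (Set.Ioo (-η₀) η₀) → Set.EqOn hsExcessFreeEnergy F (Set.Ico 0 η₀) → F 0 = 0 → ∃ KG : ℝ, 0 ≤ KG ∧ ∀ {σ : ℝ}, 0 < σ → ∀ {ρ₀ : T3 → ℝ} {δ₀ : ℝ}, 0 < δ₀ → δ₀ ≤ 1 / 2 → (∀ x, |ρ₀ x - 1| ≤ δ₀) → (∀ x, ρ₀ x * σ ^ 3 ≤ η₀ / 2) → ∀ x, 0 < ρ₀ x * Real.exp (gChem σ (ρ₀ x)) ∧ |Real.log (ρ₀ x * Real.exp (gChem σ (ρ₀ x)))| ≤ 2 * δ₀ + KG * σ ^ 3 :=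 by
  intro η₀ F hη₀ hFa hF hF0
  obtain ⟨B, hB0, hB⟩ := xm_G_bound hη₀ hFa hF0
  refine ⟨3 / 2 * B, by positivity, ?_⟩
  intro σ hσ ρ₀ δ₀ _hδ₀ hδh hclose hpack x
  obtain ⟨h1, h2⟩ := abs_le.1 (hclose x)
  have hr1 : 1 / 2 ≤ ρ₀ x := by linarith
  have hr2 : ρ₀ x ≤ 3 / 2 := by linarith
  have hr0 : 0 < ρ₀ x := by linarith
  have hσ3 : 0 < σ ^ 3 := pow_pos hσ 3
  refine ⟨mul_pos hr0 (Real.exp_pos _), ?_⟩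
  rw [Real.log_mul hr0.ne' (Real.exp_pos _).ne', Real.log_exp]
  -- the density part
  have hlog : |Real.log (ρ₀ x)| ≤ 2 * δ₀ := xm_abs_log_le hδh (hclose x)
  -- the excess chemical potential part: `g_σ(ρ₀ x) = G(ρ₀ x σ³)` inside the band `(0, η₀)`
  have hη : ρ₀ x * σ ^ 3 ∈ Ioo 0 η₀ := ⟨mul_pos hr0 hσ3, by linarith [hpack x]⟩
  have hg : gChem σ (ρ₀ x) = F (ρ₀ x * σ ^ 3) + ρ₀ x * σ ^ 3 * deriv F (ρ₀ x * σ ^ 3) := by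
    rw [gChem, hF ⟨hη.1.le, hη.2⟩, deriv_hsExcessFreeEnergy_eq hF hη]
  have hG : |gChem σ (ρ₀ x)| ≤ B * (ρ₀ x * σ ^ 3) := by
    rw [hg]
    exact hB _ ⟨hη.1.le, hpack x⟩
  have hG' : B * (ρ₀ x * σ ^ 3) ≤ 3 / 2 * B * σ ^ 3 :=
    calc B * (ρ₀ x * σ ^ 3) = B * σ ^ 3 * ρ₀ x := by ring
      _ ≤ B * σ ^ 3 * (3 / 2) := mul_le_mul_of_nonneg_left hr2 (mul_nonneg hB0 hσ3.le)
      _ = 3 / 2 * B * σ ^ 3 := by ring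
  calc |Real.log (ρ₀ x) + gChem σ (ρ₀ x)| ≤ |Real.log (ρ₀ x)| + |gChem σ (ρ₀ x)| := abs_add_le _ _
    _ ≤ 2 * δ₀ + B * (ρ₀ x * σ ^ 3) := add_le_add hlog hG
    _ ≤ 2 * δ₀ + 3 / 2 * B * σ ^ 3 := by linarith

end Summit.AtomisticToContinuum.HydrodynamicLimit.Theorems.NearConstantShortTimeHL

end
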